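import Summits.AnomalousDissipation.AnomalousDissipation.Theorems.SolenoidalFractalHomogenisationLagrangianStepVmodTransportDuality
import Literature.Analysis.FluidPDE.PassiveVectorTensorPropagatorUnique
import HarnessLib

/-!
# K1L_D (stmt-AnomalousDissipation-27980): (V_mod) flat stage — the transport-only duality bound, ADJOINT FORM (smooth datum, rough test):
# `|⟪U x, ζ⟫ − ⟪V x, ζ⟫| ≤ 3·B·(t−s)·‖ζ‖·‖∇x‖₂`
(line file of the (V_mod) lane, short-window engine F4a′ of the (ff) block (and of (fs)/(sf)); prover ad-k3l-bookkeeping-p1 g9.)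

The adjoint of a window map `U s t` of a propagator with carrier `b` and tensor `𝔹` is the window map `0 ↦ t − s` of the propagator of the REVERSED
carrier `r ↦ −b(t − r)` and the transposed tensor (`IsPropagator.adjoint_eq`), and the adjoint of the drift-free `V s t` is drift-free again; so
`abs_inner_sub_inner_driftFree_le` (p711768) applied to the reversed pair, with datum `ζ` and test `x`, gives
**`abs_inner_sub_inner_driftFree_le_adjoint`**: `|⟪U s t x, ζ⟫ − ⟪V s t x, ζ⟫| ≤ 3·B·(t − s)·‖ζ‖·√(eGradNormSq x)` for weakly divergence-free `x` of
finite enstrophy and every `ζ ∈ V2` (carrier bounded by `B` everywhere).  `sorry`-free; NOT a proof of any block, of the stub, of K1L_D or AD;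
rung F-D1.A0.
-/

set_option linter.dupNamespace false

noncomputable section

namespace Summit.AnomalousDissipation.AnomalousDissipation.Theorems.SolenoidalFractalHomogenisation.LagrangianStep.VmodFlat

open Literature.Analysis Literature.Analysis.FluidPDE Literature.Analysis.FunctionSpaces
open MeasureTheory Set Filter UnitAddTorus
open scoped ENNReal NNReal InnerProductSpace
open Summit.AnomalousDissipation.AnomalousDissipation.Theorems.SolenoidalFractalHomogenisation.LagrangianStep.CellClauseMod

set_option maxHeartbeats 400000 in
/-- **TRANSPORT-ONLY DUALITY BOUND, ADJOINT FORM.**  `U` the window propagator of carrier `b` (`‖b‖ ≤ B` everywhere, essentially bounded lift,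
a.e. weakly divergence free) and elliptic tensor `𝔹`, `V` the drift-free propagator of the same tensor; then for weakly divergence-free `x ∈ V2`
of finite enstrophy, every `ζ ∈ V2` and `0 ≤ s ≤ t ≤ T₀`:
`|⟪U s t x, ζ⟫ − ⟪V s t x, ζ⟫| ≤ 3·B·(t − s)·‖ζ‖·√((eGradNormSq x).toReal)`. [folklore] -/
theorem abs_inner_sub_inner_driftFree_le_adjoint {T₀ : ℝ} {𝔹 : Torus.Visc4 (Fin 3)} {lo' hi' : ℝ} (h𝔹 : Torus.NearIso 𝔹 lo' hi')
    (hlo' : 0 < lo') {b : ℝ → VF} (hb : MemLp (Torus.stLift b) ∞ (volume.restrict (Ioo 0 T₀ ×ˢ (univ : Set (EuclideanSpace ℝ (Fin 3))))))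
    (hbdiv : ∀ᵐ τ ∂(volume.restrict (Ioo (0:ℝ) T₀)), Torus.IsWeaklyDivFree (b τ)) {B : ℝ} (hB : 0 ≤ B) (hbB : ∀ τ y, ‖b τ y‖ ≤ B)
    {U V : ℝ → ℝ → (V2 →L[ℝ] V2)} (hU : Torus.IsPropagator T₀ b 𝔹 U)
    (hV : Torus.IsPropagator T₀ (fun (_ : ℝ) (_ : UnitAddTorus (Fin 3)) => (0 : EuclideanSpace ℝ (Fin 3))) 𝔹 V)
    {s t : ℝ} (hs : 0 ≤ s) (hst : s ≤ t) (htT : t ≤ T₀) (x ζ : V2) (hxdiv : Torus.IsWeaklyDivFree (x : VF))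
    (hx1 : Torus.eGradNormSq (x : VF) ≠ ⊤) :
    |⟪U s t x, ζ⟫_ℝ - ⟪V s t x, ζ⟫_ℝ| ≤ 3 * B * (t - s) * ‖ζ‖ * Real.sqrt ((Torus.eGradNormSq (x : VF)).toReal) := by
  rcases hst.eq_or_lt with heq | hst'
  · subst heq
    rw [hU.self_of_divFree s hs htT x hxdiv, hV.self_of_divFree s hs htT x hxdiv, sub_self, abs_zero, sub_self]
    simp
  -- zero carrier data for `V`
  have hb0 : MemLp (Torus.stLift (fun (_ : ℝ) (_ : UnitAddTorus (Fin 3)) => (0 : EuclideanSpace ℝ (Fin 3)))) ∞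
      (volume.restrict (Ioo (0:ℝ) T₀ ×ˢ (univ : Set (EuclideanSpace ℝ (Fin 3))))) := memLp_top_const 0
  have hb0div : ∀ᵐ τ ∂(volume.restrict (Ioo (0:ℝ) T₀)),
      Torus.IsWeaklyDivFree ((fun (_ : ℝ) (_ : UnitAddTorus (Fin 3)) => (0 : EuclideanSpace ℝ (Fin 3))) τ) :=
    ae_of_all _ fun τ θ hθ => by simp
  have h𝔹T : Torus.NearIso (Torus.majorTranspose 𝔹) lo' hi' := (Torus.nearIso_majorTranspose_iff 𝔹 lo' hi').2 h𝔹
  -- the reversed families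
  have hbr := Torus.memLp_top_stLift_reversed_window hb hs htT
  have hbrdiv := Torus.ae_isWeaklyDivFree_reversed_window hbdiv hs htT
  have hb0r := Torus.memLp_top_stLift_reversed_window hb0 hs htT
  have hb0rdiv := Torus.ae_isWeaklyDivFree_reversed_window hb0div hs htT
  have hUr := Torus.isPropagator_propagator h𝔹T hlo' hbr hbrdiv
  have hVr := Torus.isPropagator_propagator h𝔹T hlo' hb0r hb0rdiv
  have eU := hU.adjoint_eq h𝔹 hlo' hb hbdiv hs hst' htT
  have eV := hV.adjoint_eq h𝔹 hlo' hb0 hb0div hs hst' htT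
  set Ur := Torus.propagator h𝔹T hlo' hbr hbrdiv with hUrdef
  set Vr := Torus.propagator h𝔹T hlo' hb0r hb0rdiv with hVrdef
  -- the reversed zero carrier is the zero carrier
  have ecar : (fun r : ℝ => -((fun (_ : ℝ) (_ : UnitAddTorus (Fin 3)) => (0 : EuclideanSpace ℝ (Fin 3))) (t - r))) =
      (fun (_ : ℝ) (_ : UnitAddTorus (Fin 3)) => (0 : EuclideanSpace ℝ (Fin 3))) := by
    funext r yy; simp
  have key : ∀ car : ℝ → VF, car = (fun (_ : ℝ) (_ : UnitAddTorus (Fin 3)) => (0 : EuclideanSpace ℝ (Fin 3))) →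
      Torus.IsPropagator (t - s) car (Torus.majorTranspose 𝔹) Vr →
      Torus.IsPropagator (t - s) (fun (_ : ℝ) (_ : UnitAddTorus (Fin 3)) => (0 : EuclideanSpace ℝ (Fin 3))) (Torus.majorTranspose 𝔹) Vr := by
    rintro _ rfl h; exact h
  have hVr' := key _ ecar hVr
  -- the reversed carrier is bounded by `B`
  have hbrB : ∀ᵐ τ ∂(volume.restrict (Ioo (0:ℝ) (t - s))), ∀ᵐ y ∂volume, ‖(fun r : ℝ => -b (t - r)) τ y‖ ≤ B :=
    ae_of_all _ fun τ => ae_of_all _ fun y => by simp only [Pi.neg_apply, norm_neg]; exact hbB _ _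
  -- the transport-only duality bound for the reversed pair, datum `ζ`, test `x`
  have h := abs_inner_sub_inner_driftFree_le h𝔹T hlo' hbr hbrdiv hB hbrB hUr hVr' le_rfl (sub_nonneg.2 hst) le_rfl ζ x hxdiv hx1
  -- back to `U`, `V`
  have e1 : ⟪U s t x, ζ⟫_ℝ = ⟪Ur 0 (t - s) ζ, x⟫_ℝ := by
    rw [← ContinuousLinearMap.adjoint_inner_right, eU, real_inner_comm]
  have e2 : ⟪V s t x, ζ⟫_ℝ = ⟪Vr 0 (t - s) ζ, x⟫_ℝ := by
    rw [← ContinuousLinearMap.adjoint_inner_right, eV, real_inner_comm]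
  rw [e1, e2]
  calc |⟪Ur 0 (t - s) ζ, x⟫_ℝ - ⟪Vr 0 (t - s) ζ, x⟫_ℝ| ≤ 3 * B * (t - s - 0) * ‖ζ‖ * Real.sqrt ((Torus.eGradNormSq (x : VF)).toReal) := h
    _ = 3 * B * (t - s) * ‖ζ‖ * Real.sqrt ((Torus.eGradNormSq (x : VF)).toReal) := by rw [sub_zero]

end Summit.AnomalousDissipation.AnomalousDissipation.Theorems.SolenoidalFractalHomogenisation.LagrangianStep.VmodFlat

end
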